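import Summits.MatrixMultiplication.OmegaCensus.STPPCell22DeadF

/-!
# ω-census (abelian STPP census): cell-(2,2) certificate of the fifth leaf `{(2,2,2),(3,3,3)²} @ ℤ₆₁` — stage 3 dead rows, file 2/36

HONEST FRAMING (pub-omega census; verbatim): lottery ticket; floor = certified bounds/negative ranges.
Census STRUCTURE (seat pub-omega-stpp-1 gen 33, 2026-08-29), family (b2).  KERNEL rows (`decide +kernel`) / glue for the checkers of
`STPPCell22Checker.lean`; design and python ×1 DATUM in HOME `pub-omega-stpp-1-g33/FIFTH-LEAF.md`, generator `code/gen_cell22_rows.py`.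
Nothing here is progress on `ω`.
-/

namespace Summit.MatrixMultiplication.OmegaCensus.CubeNB.S2

open Summit.MatrixMultiplication.OmegaCensus.CubeNB.Bits

/-- Dead rows: chunk 4 (entries `[49, 66)`) fails the words cover (blocks `(3,3,3),(2,2,2)`, enumerator `WQ`, direct). [folklore] -/
theorem c22dead_Q4 : (tbl22Q4.all dead22F) = true := by decide +kernel

/-- Dead rows: chunk 5 (entries `[66, 83)`) fails the words cover (blocks `(3,3,3),(2,2,2)`, enumerator `WQ`, direct). [folklore] -/
theorem c22dead_Q5 : (tbl22Q5.all dead22F) = true := by decide +kernel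

/-- Dead rows: chunk 6 (entries `[83, 100)`) fails the words cover (blocks `(3,3,3),(2,2,2)`, enumerator `WQ`, direct). [folklore] -/
theorem c22dead_Q6 : (tbl22Q6.all dead22F) = true := by decide +kernel


end Summit.MatrixMultiplication.OmegaCensus.CubeNB.S2
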